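import Literature.Computability.Complexity.SuccinctCircuitBitsSigned
import HarnessLib

/-!
# Succinct arithmetic circuits of polynomial depth, VIII: the split-gate extension (adjoining the
# two's-complement representatives of a difference of two gates)

A consumer carrying every integer `x` as a PAIR of natural gates (`x = x⁺ − x⁻`; the KV20 M1
kernel-vector circuit of `SuccinctKernelVectorCircuit.lean`, x5 g7) reads signs and magnitudes out
through part VII (`signMag_mem_PSPACE_of_rep`) once the circuit also holds two's-complement
representatives of `x⁺ − x⁻` and of `x⁻ − x⁺`. This file adjoins them to ANY succinct circuit `K`,
generically, without touching `K`'s gate table: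

* `SuccCircuit.splitExt K : SuccCircuit` — names `false :: g` are the gates of `K` (children
  `false :: child`); names `true :: t₁ t₂ t₃ :: q` with payload `q = ⟨bin v, ⟨gp, gn⟩⟩` are, by the
  tag, the `(v+1)`-bit all-ones constant `ONES`, the products `ONES · gn`, `ONES · gp`, and the sums
  `X⁺ = gp + ONES·gn`, `X⁻ = gn + ONES·gp` (every other tag: the constant `0`). All five syntax maps
  are polynomial-time (a dispatch on four leading bits); children are no longer than parents;
  depths `K.depth`, `0`, `dpoly(|q|) + 1`, `dpoly(|q|) + 2`; `dpoly' = dpoly + 2`.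
* **`val_splitExt_old`**: `(K.splitExt).val (false :: g) = K.val g`; **`val_splitExt_xpos`** /
  **`val_splitExt_xneg`**: `val X⁺ = K.val gp + (2^{v+1} − 1)·K.val gn`, symmetrically for `X⁻`;
  hence **`xpos_rep`** / **`xneg_rep`**: `val X⁺ ≡ K.val gp − K.val gn` and
  `val X⁻ ≡ −(K.val gp − K.val gn)` modulo `2^{v+1}` (Knuth §4.1: `2^{v+1} − 1 ≡ −1`), and
  `val_splitExt_zero = 0` for the zero gate; `splitPayload_fp`, `xposName_fp`, `xnegName_fp`.

HONEST FRAMING (val-lit, KV20 M1 programme, the split-gate wrapper asked for in RULING (129)):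
generic plumbing; proves nothing about `kumarVolk2020_cor_1_3` by itself; `VP ≠ VNP` is NOT proved.

## References

* D. E. Knuth, *TAOCP 2*, §4.1 (two's complement: `−x` is represented by `2ⁿ − x`;
  `x + (2ⁿ − 1)·y ≡ x − y`) [KnuthTAOCP2].
* P. Koiran, S. Perifel, *VPSPACE and a transfer theorem over the reals*, Comput. Complexity 18
  (2009), §3.2, Prop. 1 (gates of a polynomial-depth circuit described in polynomial time)
  [KoiranPerifel2009VPSPACE].
* S. Arora, B. Barak, *Computational Complexity*, §0.1, §1.3 [AroraBarak2009].
-/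

noncomputable section

namespace Literature.Computability.Complexity

open _root_.Computability Polynomial CodeFP Brick Finset

namespace SuccCircuit

/-! ### Payloads and names -/

/-- The payload of an adjoined gate: `⟨bin v, ⟨gp, gn⟩⟩`. [cite: AroraBarak2009, §0.1 (codes of tuples)] -/
def splitPayload (v : ℕ) (gp gn : List Bool) : List Bool := pairE natE (pairE strE strE) (v, gp, gn)

/-- The width exponent of a payload. [cite: AroraBarak2009, §0.1] -/
def pV (q : List Bool) : ℕ := bitsToNat (fstF q)

/-- The positive part's gate of a payload. [cite: AroraBarak2009, §0.1] -/
def pP (q : List Bool) : List Bool := fstF (sndF q)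

/-- The negative part's gate of a payload. [cite: AroraBarak2009, §0.1] -/
def pN (q : List Bool) : List Bool := sndF (sndF q)

/-- Reading a payload. [cite: AroraBarak2009, §0.1] -/
@[simp] theorem pV_splitPayload (v : ℕ) (gp gn : List Bool) : pV (splitPayload v gp gn) = v := by
  simp [pV, splitPayload, pairE, natE]

/-- Reading a payload. [cite: AroraBarak2009, §0.1] -/
@[simp] theorem pP_splitPayload (v : ℕ) (gp gn : List Bool) : pP (splitPayload v gp gn) = gp := by
  simp [pP, splitPayload, pairE, strE]

/-- Reading a payload. [cite: AroraBarak2009, §0.1] -/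
@[simp] theorem pN_splitPayload (v : ℕ) (gp gn : List Bool) : pN (splitPayload v gp gn) = gn := by
  simp [pN, splitPayload, pairE, strE]

/-- The parts of a payload are no longer than the payload. [cite: AroraBarak2009, §0.1] -/
theorem length_pP_le (q : List Bool) : (pP q).length ≤ q.length := by
  have h1 := length_boolUnpair_parts_le q
  have h2 := length_boolUnpair_parts_le (sndF q)
  change (boolUnpair (boolUnpair q).2).1.length ≤ _
  change 2 * (boolUnpair (boolUnpair q).2).1.length + _ ≤ (boolUnpair q).2.length at h2
  omega

/-- The parts of a payload are no longer than the payload. [cite: AroraBarak2009, §0.1] -/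
theorem length_pN_le (q : List Bool) : (pN q).length ≤ q.length := by
  have h1 := length_boolUnpair_parts_le q
  have h2 := length_boolUnpair_parts_le (sndF q)
  change (boolUnpair (boolUnpair q).2).2.length ≤ _
  change 2 * (boolUnpair (boolUnpair q).2).1.length + (boolUnpair (boolUnpair q).2).2.length ≤ (boolUnpair q).2.length at h2
  omega

/-- The all-ones constant gate of a payload (tag `000`). [cite: KnuthTAOCP2, §4.1] -/
def onesName (q : List Bool) : List Bool := [true, false, false, false] ++ q
/-- The gate `ONES · gn` (tag `001`). [cite: KnuthTAOCP2, §4.1] -/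
def prodNName (q : List Bool) : List Bool := [true, false, false, true] ++ q
/-- The gate `ONES · gp` (tag `010`). [cite: KnuthTAOCP2, §4.1] -/
def prodPName (q : List Bool) : List Bool := [true, false, true, false] ++ q
/-- The gate `X⁺ = gp + ONES · gn` (tag `011`). [cite: KnuthTAOCP2, §4.1] -/
def xposName (q : List Bool) : List Bool := [true, false, true, true] ++ q
/-- The gate `X⁻ = gn + ONES · gp` (tag `100`). [cite: KnuthTAOCP2, §4.1] -/
def xnegName (q : List Bool) : List Bool := [true, true, false, false] ++ q
/-- The zero constant gate of the extension: the empty name (a dead constant of width `0`). [cite: KnuthTAOCP2, §4.1] -/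
def zeroName : List Bool := []

variable (K : SuccCircuit)

/-! ### The extended syntax (dispatch on the four leading bits) -/

/-- The tag of an adjoined name, read off bits `1,2,3`: `0` ONES, `1` ONES·gn, `2` ONES·gp, `3` X⁺,
`4` X⁻, `5–7` dead. [cite: AroraBarak2009, §0.1] -/
def tagOf (g : List Bool) : ℕ :=
  (if g.getD 1 false then 4 else 0) + (if g.getD 2 false then 2 else 0) + (if g.getD 3 false then 1 else 0)

/-- Kind of an extended gate: adjoined names (leading bit `1`, length `≥ 4`) by their tag; `false :: g`
delegates to `K`; the empty name and short adjoined names are dead constants. [cite: KoiranPerifel2009VPSPACE, §3.2] -/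
def extKind (g : List Bool) : ℕ :=
  if g.getD 0 false then
    (if 4 ≤ g.length then
      (if tagOf g = 0 then 0 else if tagOf g = 1 then 2 else if tagOf g = 2 then 2
        else if tagOf g = 3 then 1 else if tagOf g = 4 then 1 else 0)
    else 0)
  else if g = [] then 0 else K.kind (g.drop 1)

/-- Width of an extended gate (the all-ones constant has `v + 1` bits; dead constants `0`; old gates
keep theirs). [cite: KnuthTAOCP2, §4.1] -/
def extWidth (g : List Bool) : ℕ :=
  if g.getD 0 false then (if 4 ≤ g.length then (if tagOf g = 0 then pV (g.drop 4) + 1 else 0) else 0)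
  else if g = [] then 0 else K.width (g.drop 1)

/-- Constant bits of an extended gate (all ones for adjoined constants; old gates keep theirs). [cite: KnuthTAOCP2, §4.1] -/
def extCbit (g : List Bool) (i : ℕ) : Bool :=
  if g.getD 0 false then true else K.cbit (g.drop 1) i

/-- Arity of an extended gate (the two adjoined sums have arity `2`). [cite: KoiranPerifel2009VPSPACE, §3.2] -/
def extArity (g : List Bool) : ℕ :=
  if g.getD 0 false then 2 else K.arity (g.drop 1)

/-- Children of an extended gate: by tag, `ONES·gn ↦ (ONES, gn)`, `ONES·gp ↦ (ONES, gp)`,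
`X⁺ ↦ (gp, ONES·gn)`, `X⁻ ↦ (gn, ONES·gp)`; old gates `false :: g ↦ false :: child`. [cite: KoiranPerifel2009VPSPACE, §3.2] -/
def extChild (g : List Bool) (k : ℕ) : List Bool :=
  if g.getD 0 false then
    (if tagOf g = 1 then (if k = 0 then onesName (g.drop 4) else [false] ++ pN (g.drop 4))
      else if tagOf g = 2 then (if k = 0 then onesName (g.drop 4) else [false] ++ pP (g.drop 4))
      else if tagOf g = 3 then (if k = 0 then [false] ++ pP (g.drop 4) else prodNName (g.drop 4))
      else (if k = 0 then [false] ++ pN (g.drop 4) else prodPName (g.drop 4)))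
  else [false] ++ K.child (g.drop 1) k

/-- Depth of an extended gate: `ONES` `0`, products `dpoly(|q|) + 1`, sums `dpoly(|q|) + 2`, old gates
as in `K`. [cite: KoiranPerifel2009VPSPACE, §3.2] -/
def extDepth (g : List Bool) : ℕ :=
  if g.getD 0 false then
    (if 4 ≤ g.length then
      (if tagOf g = 0 then 0 else if tagOf g = 1 then K.dpoly.eval (g.drop 4).length + 1
        else if tagOf g = 2 then K.dpoly.eval (g.drop 4).length + 1
        else if tagOf g = 3 then K.dpoly.eval (g.drop 4).length + 2
        else if tagOf g = 4 then K.dpoly.eval (g.drop 4).length + 2 else 0)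
    else 0)
  else K.depth (g.drop 1)

/-! ### Polynomial time of the extended syntax -/

section FP

variable {α : Type} {eα : α → List Bool}

/-- Reading a fixed bit of a computed string. [cite: AroraBarak2009, §1.3] -/
private theorem getD_fp {s : α → List Bool} (hs : CodeFP eα strE s) (i : ℕ) :
    CodeFP eα bitE (fun a => (s a).getD i false) :=
  (strGetD.comp ((const eα i).pair hs)).congr fun _ => rfl

/-- Dropping a fixed prefix of a computed string. [cite: AroraBarak2009, §1.3] -/
private theorem drop_fp {s : α → List Bool} (hs : CodeFP eα strE s) (i : ℕ) :
    CodeFP eα strE (fun a => (s a).drop i) :=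
  (strDrop.comp ((const eα i).pair hs)).congr fun _ => rfl

/-- Prefixing a computed string by a fixed string. [cite: AroraBarak2009, §1.3] -/
private theorem pre_fp (t : List Bool) {s : α → List Bool} (hs : CodeFP eα strE s) :
    CodeFP eα strE (fun a => t ++ s a) :=
  (strAppend.comp ((const eα t).pair hs)).congr fun _ => rfl

/-- The tag is polynomial-time. [cite: AroraBarak2009, §1.3] -/
private theorem tagOf_fp {s : α → List Bool} (hs : CodeFP eα strE s) : CodeFP eα natE (fun a => tagOf (s a)) := by
  have b := fun i => getD_fp hs i
  have c := fun n : ℕ => (const eα n : CodeFP eα natE fun _ => n)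
  exact (natAdd.comp ((natAdd.comp (((b 1).ite (c 4) (c 0)).pair ((b 2).ite (c 2) (c 0)))).pair
    ((b 3).ite (c 1) (c 0)))).congr fun a => by simp only [tagOf]

/-- The length guard is polynomial-time. [cite: AroraBarak2009, §1.3] -/
private theorem len4_fp {s : α → List Bool} (hs : CodeFP eα strE s) : CodeFP eα bitE (fun a => decide (4 ≤ (s a).length)) :=
  natLeUn.comp ((const eα (4 : ℕ)).pair (strLength.comp hs))

/-- The emptiness test is polynomial-time. [cite: AroraBarak2009, §1.3] -/
private theorem nil_fp {s : α → List Bool} (hs : CodeFP eα strE s) : CodeFP eα bitE (fun a => decide (s a = [])) :=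
  (CodeFP.eq (eα := strE) fun _ _ h => h).comp (hs.pair (const eα ([] : List Bool)))

/-- The payload readers are polynomial-time. [cite: AroraBarak2009, §1.3] -/
theorem pV_fp : CodeFP strE natE pV := (strVal.comp (of_fn fstF fstF_mem_FP fun _ => rfl)).congr fun _ => rfl

/-- The payload readers are polynomial-time. [cite: AroraBarak2009, §1.3] -/
theorem pP_fp : CodeFP strE strE pP :=
  ((of_fn fstF fstF_mem_FP fun _ => rfl : CodeFP strE strE fstF).comp
    (of_fn sndF sndF_mem_FP fun _ => rfl : CodeFP strE strE sndF)).congr fun _ => rfl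

/-- The payload readers are polynomial-time. [cite: AroraBarak2009, §1.3] -/
theorem pN_fp : CodeFP strE strE pN :=
  ((of_fn sndF sndF_mem_FP fun _ => rfl : CodeFP strE strE sndF).comp
    (of_fn sndF sndF_mem_FP fun _ => rfl : CodeFP strE strE sndF)).congr fun _ => rfl

/-- Payloads are assembled in polynomial time. [cite: AroraBarak2009, §1.3] -/
theorem splitPayload_fp : CodeFP (pairE natE (pairE strE strE)) strE (fun p => splitPayload p.1 p.2.1 p.2.2) :=
  (CodeFP.id _).recodeOut (eγ := strE) fun _ => rfl

/-- `X⁺` names are assembled in polynomial time. [cite: AroraBarak2009, §1.3] -/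
theorem xposName_fp : CodeFP strE strE xposName := pre_fp _ (CodeFP.id strE)

/-- `X⁻` names are assembled in polynomial time. [cite: AroraBarak2009, §1.3] -/
theorem xnegName_fp : CodeFP strE strE xnegName := pre_fp _ (CodeFP.id strE)

/-- A tag test is polynomial-time. [cite: AroraBarak2009, §1.3] -/
private theorem tagEq_fp {s : α → List Bool} (hs : CodeFP eα strE s) (n : ℕ) :
    CodeFP eα bitE (fun a => decide (tagOf (s a) = n)) :=
  natEq.comp ((tagOf_fp hs).pair (const eα n))

/-- The extended kind is polynomial-time. [cite: AroraBarak2009, §1.3] -/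
theorem extKind_fp : CodeFP strE natE K.extKind := by
  have hid := CodeFP.id strE
  have t := fun n => tagEq_fp hid n
  have c := fun n : ℕ => (const strE n : CodeFP strE natE fun _ => n)
  have hold : CodeFP strE natE (fun g => K.kind (g.drop 1)) := K.kind_fp.comp (drop_fp hid 1)
  refine (((getD_fp hid 0).ite ((len4_fp hid).ite ((t 0).ite (c 0) ((t 1).ite (c 2) ((t 2).ite (c 2)
    ((t 3).ite (c 1) ((t 4).ite (c 1) (c 0)))))) (c 0)) ((nil_fp hid).ite (c 0) hold))).congr fun g => ?_
  simp only [extKind, decide_eq_true_eq, id]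

/-- The extended width is polynomial-time. [cite: AroraBarak2009, §1.3] -/
theorem extWidth_fp : CodeFP strE natE K.extWidth := by
  have hid := CodeFP.id strE
  have c0 : CodeFP strE natE (fun _ => (0 : ℕ)) := const strE (0 : ℕ)
  have hold : CodeFP strE natE (fun g => K.width (g.drop 1)) := K.width_fp.comp (drop_fp hid 1)
  have hv : CodeFP strE natE (fun g => pV (g.drop 4) + 1) :=
    natAdd.comp ((pV_fp.comp (drop_fp hid 4)).pair (const strE (1 : ℕ)))
  refine (((getD_fp hid 0).ite ((len4_fp hid).ite ((tagEq_fp hid 0).ite hv c0) c0) ((nil_fp hid).ite c0 hold))).congr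
    fun g => ?_
  simp only [extWidth, decide_eq_true_eq, id]

/-- The extended constant bits are polynomial-time. [cite: AroraBarak2009, §1.3] -/
theorem extCbit_fp : CodeFP (pairE strE natE) bitE (fun p => K.extCbit p.1 p.2) := by
  have b0 : CodeFP (pairE strE natE) bitE (fun p => p.1.getD 0 false) := getD_fp (fst _ _) 0
  have hold : CodeFP (pairE strE natE) bitE (fun p => K.cbit (p.1.drop 1) p.2) :=
    K.cbit_fp.comp ((drop_fp (fst _ _) 1).pair (snd _ _))
  exact (b0.ite (const _ true) hold).congr fun p => by simp only [extCbit]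

/-- The extended arity is polynomial-time. [cite: AroraBarak2009, §1.3] -/
theorem extArity_fp : CodeFP strE natE K.extArity := by
  have b0 := getD_fp (CodeFP.id strE) 0
  have hold : CodeFP strE natE (fun g => K.arity (g.drop 1)) := K.arity_fp.comp (drop_fp (CodeFP.id strE) 1)
  exact (b0.ite (const strE (2 : ℕ)) hold).congr fun g => rfl

/-- The extended children are polynomial-time. [cite: AroraBarak2009, §1.3] -/
theorem extChild_fp : CodeFP (pairE strE natE) strE (fun p => K.extChild p.1 p.2) := by
  have hg : CodeFP (pairE strE natE) strE (fun p => p.1) := fst _ _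
  have t := fun n => tagEq_fp hg n
  have hk0 : CodeFP (pairE strE natE) bitE (fun p => decide (p.2 = 0)) :=
    natEq.comp ((snd _ _).pair (const _ (0 : ℕ)))
  have hq : CodeFP (pairE strE natE) strE (fun p => p.1.drop 4) := drop_fp hg 4
  have hPn : CodeFP (pairE strE natE) strE (fun p => [false] ++ pN (p.1.drop 4)) := pre_fp _ (pN_fp.comp hq)
  have hPp : CodeFP (pairE strE natE) strE (fun p => [false] ++ pP (p.1.drop 4)) := pre_fp _ (pP_fp.comp hq)
  have hones : CodeFP (pairE strE natE) strE (fun p => onesName (p.1.drop 4)) := pre_fp _ hq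
  have hprodN : CodeFP (pairE strE natE) strE (fun p => prodNName (p.1.drop 4)) := pre_fp _ hq
  have hprodP : CodeFP (pairE strE natE) strE (fun p => prodPName (p.1.drop 4)) := pre_fp _ hq
  have hold : CodeFP (pairE strE natE) strE (fun p => [false] ++ K.child (p.1.drop 1) p.2) :=
    pre_fp _ (K.child_fp.comp ((drop_fp hg 1).pair (snd _ _)))
  refine (((getD_fp hg 0).ite ((t 1).ite (hk0.ite hones hPn) ((t 2).ite (hk0.ite hones hPp)
    ((t 3).ite (hk0.ite hPp hprodN) (hk0.ite hPn hprodP)))) hold)).congr fun p => ?_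
  simp only [extChild, decide_eq_true_eq]

end FP

/-! ### The extension circuit -/

variable {K}

/-- The tag is at most `7`. [cite: AroraBarak2009, §0.1] -/
private theorem tagOf_le (g : List Bool) : tagOf g ≤ 7 := by
  unfold tagOf; split_ifs <;> omega

/-- An adjoined gate with children is at least four symbols long and has tag `1–4`, and `k < 2`. [cite: AroraBarak2009, §0.1] -/
private theorem new_of_fanIn {g : List Bool} {k : ℕ} (h0 : g.getD 0 false = true)
    (hk : k < gateFanIn (K.extKind g) (K.extArity g)) :
    4 ≤ g.length ∧ k < 2 ∧ (tagOf g = 1 ∨ tagOf g = 2 ∨ tagOf g = 3 ∨ tagOf g = 4) := by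
  simp only [extKind, extArity, h0, if_true] at hk
  by_cases hl : 4 ≤ g.length
  · simp only [hl, if_true] at hk
    obtain ⟨t, ht⟩ : ∃ t, tagOf g = t := ⟨_, rfl⟩
    have ht7 : t ≤ 7 := ht ▸ tagOf_le g
    rw [ht] at hk ⊢
    interval_cases t <;> simp [gateFanIn] at hk ⊢ <;> omega
  · simp [hl, gateFanIn] at hk

/-- An old gate with children is nonempty. [cite: AroraBarak2009, §0.1] -/
private theorem old_of_fanIn {g : List Bool} {k : ℕ} (h0 : ¬ g.getD 0 false = true)
    (hk : k < gateFanIn (K.extKind g) (K.extArity g)) :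
    g ≠ [] ∧ k < gateFanIn (K.kind (g.drop 1)) (K.arity (g.drop 1)) := by
  simp only [extKind, extArity, h0] at hk
  by_cases hn : g = []
  · subst hn; simp [gateFanIn] at hk
  · simp only [hn, if_false] at hk
    exact ⟨hn, hk⟩

/-- Depth of the all-ones gate. [cite: KnuthTAOCP2, §4.1] -/
private theorem extDepth_onesName (q : List Bool) : K.extDepth (onesName q) = 0 := by
  simp [extDepth, onesName, tagOf]

/-- Depth of the product `ONES · gn`. [cite: KnuthTAOCP2, §4.1] -/
private theorem extDepth_prodNName (q : List Bool) : K.extDepth (prodNName q) = K.dpoly.eval q.length + 1 := by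
  simp [extDepth, prodNName, tagOf]

/-- Depth of the product `ONES · gp`. [cite: KnuthTAOCP2, §4.1] -/
private theorem extDepth_prodPName (q : List Bool) : K.extDepth (prodPName q) = K.dpoly.eval q.length + 1 := by
  simp [extDepth, prodPName, tagOf]

/-- Depth of an old gate. [cite: KoiranPerifel2009VPSPACE, §3.2] -/
private theorem extDepth_old (t : List Bool) : K.extDepth ([false] ++ t) = K.depth t := by
  simp [extDepth]

/-- Depth of an adjoined gate with children, by tag. [cite: KoiranPerifel2009VPSPACE, §3.2] -/
private theorem extDepth_new {g : List Bool} (h0 : g.getD 0 false = true) (hl : 4 ≤ g.length) :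
    (tagOf g = 1 → K.extDepth g = K.dpoly.eval (g.drop 4).length + 1) ∧
    (tagOf g = 2 → K.extDepth g = K.dpoly.eval (g.drop 4).length + 1) ∧
    (tagOf g = 3 → K.extDepth g = K.dpoly.eval (g.drop 4).length + 2) ∧
    (tagOf g = 4 → K.extDepth g = K.dpoly.eval (g.drop 4).length + 2) := by
  have h0n : g[0]?.getD false = true := by simpa using h0
  refine ⟨fun ht => ?_, fun ht => ?_, fun ht => ?_, fun ht => ?_⟩ <;> simp [extDepth, h0n, hl, ht]

/-- Children of an adjoined gate with children, by tag and index. [cite: KoiranPerifel2009VPSPACE, §3.2] -/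
private theorem extChild_new {g : List Bool} (h0 : g.getD 0 false = true) :
    (tagOf g = 1 → K.extChild g 0 = onesName (g.drop 4) ∧ K.extChild g 1 = [false] ++ pN (g.drop 4)) ∧
    (tagOf g = 2 → K.extChild g 0 = onesName (g.drop 4) ∧ K.extChild g 1 = [false] ++ pP (g.drop 4)) ∧
    (tagOf g = 3 → K.extChild g 0 = [false] ++ pP (g.drop 4) ∧ K.extChild g 1 = prodNName (g.drop 4)) ∧
    (tagOf g = 4 → K.extChild g 0 = [false] ++ pN (g.drop 4) ∧ K.extChild g 1 = prodPName (g.drop 4)) := by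
  have h0n : g[0]?.getD false = true := by simpa using h0
  refine ⟨fun ht => ?_, fun ht => ?_, fun ht => ?_, fun ht => ?_⟩ <;> simp [extChild, h0n, ht]

variable (K)

/-- **The split-gate extension of a succinct circuit.** [cite: KoiranPerifel2009VPSPACE, §3.2, Prop. 1] [cite: KnuthTAOCP2, §4.1] -/
def splitExt : SuccCircuit where
  kind := K.extKind
  width := K.extWidth
  cbit := K.extCbit
  arity := K.extArity
  child := K.extChild
  depth := K.extDepth
  dpoly := K.dpoly + 2
  kind_fp := K.extKind_fp
  width_fp := K.extWidth_fp
  cbit_fp := K.extCbit_fp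
  arity_fp := K.extArity_fp
  child_fp := K.extChild_fp
  depth_child := by
    intro g k hk
    show K.extDepth (K.extChild g k) < K.extDepth g
    by_cases h0 : g.getD 0 false = true
    · obtain ⟨hl, hk2, htag⟩ := new_of_fanIn h0 hk
      have hmono : ∀ t : List Bool, t.length ≤ (g.drop 4).length → K.depth t ≤ K.dpoly.eval (g.drop 4).length :=
        fun t ht => (K.depth_le t).trans (TM2Iter.eval_mono _ ht)
      have hP := hmono _ (length_pP_le (g.drop 4))
      have hN := hmono _ (length_pN_le (g.drop 4))
      obtain ⟨d1, d2, d3, d4⟩ := extDepth_new (K := K) h0 hl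
      obtain ⟨c1, c2, c3, c4⟩ := extChild_new (K := K) h0
      rcases htag with ht | ht | ht | ht <;> rcases (show k = 0 ∨ k = 1 by omega) with rfl | rfl
      · rw [(c1 ht).1, d1 ht, extDepth_onesName]; omega
      · rw [(c1 ht).2, d1 ht, extDepth_old]; omega
      · rw [(c2 ht).1, d2 ht, extDepth_onesName]; omega
      · rw [(c2 ht).2, d2 ht, extDepth_old]; omega
      · rw [(c3 ht).1, d3 ht, extDepth_old]; omega
      · rw [(c3 ht).2, d3 ht, extDepth_prodNName]; omega
      · rw [(c4 ht).1, d4 ht, extDepth_old]; omega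
      · rw [(c4 ht).2, d4 ht, extDepth_prodPName]; omega
    · obtain ⟨hn, hk'⟩ := old_of_fanIn h0 hk
      have h0n : g[0]?.getD false = false := by simpa using h0
      have hc : K.extChild g k = [false] ++ K.child (g.drop 1) k := by simp [extChild, h0n]
      have hd : K.extDepth g = K.depth (g.drop 1) := by simp [extDepth, h0n]
      rw [hc, hd, extDepth_old]
      exact K.depth_child _ k hk'
  length_child := by
    intro g k hk
    show (K.extChild g k).length ≤ g.length
    by_cases h0 : g.getD 0 false = true
    · obtain ⟨hl, hk2, htag⟩ := new_of_fanIn h0 hk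
      have hq : (g.drop 4).length + 4 = g.length := by rw [List.length_drop]; omega
      have hP := length_pP_le (g.drop 4)
      have hN := length_pN_le (g.drop 4)
      obtain ⟨c1, c2, c3, c4⟩ := extChild_new (K := K) h0
      rcases htag with ht | ht | ht | ht <;> rcases (show k = 0 ∨ k = 1 by omega) with rfl | rfl
      · rw [(c1 ht).1]; simp only [onesName, List.length_append, List.length_cons, List.length_nil]; omega
      · rw [(c1 ht).2]; simp only [List.length_append, List.length_singleton]; omega
      · rw [(c2 ht).1]; simp only [onesName, List.length_append, List.length_cons, List.length_nil]; omega
      · rw [(c2 ht).2]; simp only [List.length_append, List.length_singleton]; omega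
      · rw [(c3 ht).1]; simp only [List.length_append, List.length_singleton]; omega
      · rw [(c3 ht).2]; simp only [prodNName, List.length_append, List.length_cons, List.length_nil]; omega
      · rw [(c4 ht).1]; simp only [List.length_append, List.length_singleton]; omega
      · rw [(c4 ht).2]; simp only [prodPName, List.length_append, List.length_cons, List.length_nil]; omega
    · obtain ⟨hn, hk'⟩ := old_of_fanIn h0 hk
      have h0n : g[0]?.getD false = false := by simpa using h0
      have hc : K.extChild g k = [false] ++ K.child (g.drop 1) k := by simp [extChild, h0n]
      rw [hc]
      simp only [List.length_append, List.length_singleton]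
      have h1 := K.length_child _ k hk'
      have h2 : (g.drop 1).length + 1 = g.length := by
        rw [List.length_drop]; have := List.length_pos_iff.2 hn; omega
      omega
  depth_le := by
    intro g
    show K.extDepth g ≤ (K.dpoly + 2).eval g.length
    rw [eval_add, eval_ofNat]
    by_cases h0 : g.getD 0 false = true
    · have hq : K.dpoly.eval (g.drop 4).length ≤ K.dpoly.eval g.length :=
        TM2Iter.eval_mono _ (by rw [List.length_drop]; omega)
      simp only [extDepth, h0, if_true]
      split_ifs <;> omega
    · have h0' : g.getD 0 false = false := by simpa using h0
      simp only [extDepth, h0', Bool.false_eq_true, if_false]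
      exact (K.depth_le _).trans ((TM2Iter.eval_mono _ (by rw [List.length_drop]; omega)).trans (Nat.le_add_right _ _))

/-! ### Values of the extension -/

/-- `∑_{i<W} 2^i = 2^W − 1`. [cite: KnuthTAOCP2, §4.1] -/
private theorem sum_two_pow_eq (W : ℕ) : ∑ i ∈ range W, 2 ^ i = 2 ^ W - 1 := by
  induction W with
  | zero => simp
  | succ W ih => rw [sum_range_succ, ih, pow_succ]; have := Nat.one_le_two_pow (n := W); omega

/-- The syntax of an old gate. [cite: KoiranPerifel2009VPSPACE, §3.2] -/
private theorem ext_old (g : List Bool) :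
    K.splitExt.kind (false :: g) = K.kind g ∧ K.splitExt.width (false :: g) = K.width g ∧
    K.splitExt.arity (false :: g) = K.arity g ∧ (∀ i, K.splitExt.cbit (false :: g) i = K.cbit g i) ∧
    (∀ k, K.splitExt.child (false :: g) k = false :: K.child g k) ∧ K.splitExt.depth (false :: g) = K.depth g := by
  refine ⟨?_, ?_, ?_, fun i => ?_, fun k => ?_, ?_⟩
  · show K.extKind (false :: g) = _; simp [extKind]
  · show K.extWidth (false :: g) = _; simp [extWidth]
  · show K.extArity (false :: g) = _; simp [extArity]
  · show K.extCbit (false :: g) i = _; simp [extCbit]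
  · show K.extChild (false :: g) k = _; simp [extChild]
  · show K.extDepth (false :: g) = _; simp [extDepth]

/-- **Old gates keep their values**: `val (false :: g) = K.val g`. [cite: KoiranPerifel2009VPSPACE, §3.2, Prop. 1 (proof: induction on the depth)] -/
theorem val_splitExt_old : ∀ (n : ℕ) (g : List Bool), K.depth g ≤ n → K.splitExt.val (false :: g) = K.val g := by
  intro n
  induction n using Nat.strong_induction_on with
  | _ n ih =>
    intro g hg
    obtain ⟨hk, hw, ha, hc, hch, hd⟩ := K.ext_old g
    have hchild : ∀ k, k < gateFanIn (K.kind g) (K.arity g) →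
        K.splitExt.val (false :: K.child g k) = K.val (K.child g k) := fun k hkk => by
      have hlt := K.depth_child g k hkk
      exact ih (K.depth (K.child g k)) (by omega) _ le_rfl
    by_cases h1 : K.kind g = 1
    · rw [K.splitExt.val_sum (by rw [hk, h1]), K.val_sum h1, ha]
      refine sum_congr rfl fun k hkr => ?_
      rw [hch, hchild k (by simp [gateFanIn, h1, mem_range.1 hkr])]
    · by_cases h2 : K.kind g = 2
      · rw [K.splitExt.val_mul (by rw [hk, h2]), K.val_mul h2, hch, hch,
          hchild 0 (by simp [gateFanIn, h2]), hchild 1 (by simp [gateFanIn, h2])]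
      · by_cases h3 : K.kind g = 3
        · rw [K.splitExt.val_mux (by rw [hk, h3]), K.val_mux h3, hch, hch, hch, hch, hw,
            hchild 0 (by simp [gateFanIn, h3]), hchild 1 (by simp [gateFanIn, h3]),
            hchild 2 (by simp [gateFanIn, h3]), hchild 3 (by simp [gateFanIn, h3])]
        · rw [K.splitExt.val_const (by rw [hk]; exact h1) (by rw [hk]; exact h2) (by rw [hk]; exact h3),
            K.val_const h1 h2 h3]
          unfold cval
          rw [hw]
          exact sum_congr rfl fun i _ => by rw [hc]

/-- Old gates keep their values (depth-free form). [cite: KoiranPerifel2009VPSPACE, §3.2, Prop. 1] -/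
theorem val_splitExt_old' (g : List Bool) : K.splitExt.val (false :: g) = K.val g :=
  K.val_splitExt_old _ g le_rfl

/-- **The all-ones gate holds `2^{v+1} − 1`.** [cite: KnuthTAOCP2, §4.1] -/
theorem val_splitExt_ones (q : List Bool) : K.splitExt.val (onesName q) = 2 ^ (pV q + 1) - 1 := by
  have hk : K.splitExt.kind (onesName q) = 0 := by simp [splitExt, extKind, onesName, tagOf]
  have hw : K.splitExt.width (onesName q) = pV q + 1 := by simp [splitExt, extWidth, onesName, tagOf]
  have hc : ∀ i, K.splitExt.cbit (onesName q) i = true := fun i => by simp [splitExt, extCbit, onesName]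
  rw [K.splitExt.val_const (by rw [hk]; norm_num) (by rw [hk]; norm_num) (by rw [hk]; norm_num)]
  unfold cval
  rw [hw, ← sum_two_pow_eq]
  exact sum_congr rfl fun i _ => by rw [hc i, if_pos rfl]

/-- **The product gate `ONES · gn`.** [cite: KnuthTAOCP2, §4.1] -/
theorem val_splitExt_prodN (q : List Bool) : K.splitExt.val (prodNName q) = (2 ^ (pV q + 1) - 1) * K.val (pN q) := by
  have hk : K.splitExt.kind (prodNName q) = 2 := by simp [splitExt, extKind, prodNName, tagOf]
  have h0 : K.splitExt.child (prodNName q) 0 = onesName q := by simp [splitExt, extChild, prodNName, tagOf]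
  have h1 : K.splitExt.child (prodNName q) 1 = false :: pN q := by simp [splitExt, extChild, prodNName, tagOf]
  rw [K.splitExt.val_mul hk, h0, h1, val_splitExt_ones, val_splitExt_old']

/-- **The product gate `ONES · gp`.** [cite: KnuthTAOCP2, §4.1] -/
theorem val_splitExt_prodP (q : List Bool) : K.splitExt.val (prodPName q) = (2 ^ (pV q + 1) - 1) * K.val (pP q) := by
  have hk : K.splitExt.kind (prodPName q) = 2 := by simp [splitExt, extKind, prodPName, tagOf]
  have h0 : K.splitExt.child (prodPName q) 0 = onesName q := by simp [splitExt, extChild, prodPName, tagOf]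
  have h1 : K.splitExt.child (prodPName q) 1 = false :: pP q := by simp [splitExt, extChild, prodPName, tagOf]
  rw [K.splitExt.val_mul hk, h0, h1, val_splitExt_ones, val_splitExt_old']

/-- **The sum gate `X⁺ = gp + ONES · gn`.** [cite: KnuthTAOCP2, §4.1] -/
theorem val_splitExt_xpos (q : List Bool) :
    K.splitExt.val (xposName q) = K.val (pP q) + (2 ^ (pV q + 1) - 1) * K.val (pN q) := by
  have hk : K.splitExt.kind (xposName q) = 1 := by simp [splitExt, extKind, xposName, tagOf]
  have ha : K.splitExt.arity (xposName q) = 2 := by simp [splitExt, extArity, xposName]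
  have h0 : K.splitExt.child (xposName q) 0 = false :: pP q := by simp [splitExt, extChild, xposName, tagOf]
  have h1 : K.splitExt.child (xposName q) 1 = prodNName q := by simp [splitExt, extChild, xposName, tagOf]
  rw [K.splitExt.val_sum hk, ha, sum_range_succ, sum_range_succ, sum_range_zero, zero_add, h0, h1,
    val_splitExt_old', val_splitExt_prodN]

/-- **The sum gate `X⁻ = gn + ONES · gp`.** [cite: KnuthTAOCP2, §4.1] -/
theorem val_splitExt_xneg (q : List Bool) :
    K.splitExt.val (xnegName q) = K.val (pN q) + (2 ^ (pV q + 1) - 1) * K.val (pP q) := by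
  have hk : K.splitExt.kind (xnegName q) = 1 := by simp [splitExt, extKind, xnegName, tagOf]
  have ha : K.splitExt.arity (xnegName q) = 2 := by simp [splitExt, extArity, xnegName]
  have h0 : K.splitExt.child (xnegName q) 0 = false :: pN q := by simp [splitExt, extChild, xnegName, tagOf]
  have h1 : K.splitExt.child (xnegName q) 1 = prodPName q := by simp [splitExt, extChild, xnegName, tagOf]
  rw [K.splitExt.val_sum hk, ha, sum_range_succ, sum_range_succ, sum_range_zero, zero_add, h0, h1,
    val_splitExt_old', val_splitExt_prodP]

/-- **The zero gate holds `0`.** [cite: KnuthTAOCP2, §4.1] -/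
theorem val_splitExt_zero : K.splitExt.val zeroName = 0 := by
  have hk : K.splitExt.kind zeroName = 0 := by simp [splitExt, extKind, zeroName]
  have hw : K.splitExt.width zeroName = 0 := by simp [splitExt, extWidth, zeroName]
  rw [K.splitExt.val_const (by rw [hk]; norm_num) (by rw [hk]; norm_num) (by rw [hk]; norm_num)]
  unfold cval
  rw [hw, sum_range_zero]

/-- `x + (2^{v+1} − 1)·y ≡ x − y (mod 2^{v+1})`. [cite: KnuthTAOCP2, §4.1] -/
private theorem add_ones_mul_modEq (v x y : ℕ) :
    (((x + (2 ^ (v + 1) - 1) * y : ℕ)) : ℤ) ≡ (x : ℤ) - y [ZMOD 2 ^ (v + 1)] := by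
  have h1 : ((2 ^ (v + 1) - 1 : ℕ) : ℤ) = 2 ^ (v + 1) - 1 := by
    rw [Nat.cast_sub (Nat.one_le_two_pow), Nat.cast_pow]; norm_num
  refine Int.modEq_iff_dvd.2 ⟨-(y : ℤ), ?_⟩
  push_cast [h1]
  ring

/-- **`X⁺` represents `gp − gn`** modulo `2^{v+1}`. [cite: KnuthTAOCP2, §4.1 ("−x is represented by 2ⁿ − x")] -/
theorem xpos_rep (v : ℕ) (gp gn : List Bool) :
    ((K.splitExt.val (xposName (splitPayload v gp gn)) : ℕ) : ℤ) ≡ (K.val gp : ℤ) - K.val gn [ZMOD 2 ^ (v + 1)] := by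
  rw [val_splitExt_xpos, pP_splitPayload, pN_splitPayload, pV_splitPayload]
  exact add_ones_mul_modEq v _ _

/-- **`X⁻` represents `−(gp − gn)`** modulo `2^{v+1}`. [cite: KnuthTAOCP2, §4.1] -/
theorem xneg_rep (v : ℕ) (gp gn : List Bool) :
    ((K.splitExt.val (xnegName (splitPayload v gp gn)) : ℕ) : ℤ) ≡ -((K.val gp : ℤ) - K.val gn) [ZMOD 2 ^ (v + 1)] := by
  rw [val_splitExt_xneg, pP_splitPayload, pN_splitPayload, pV_splitPayload, neg_sub]
  exact add_ones_mul_modEq v _ _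

end SuccCircuit

end Literature.Computability.Complexity
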